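import Summits.Ventures.Crystal3D.Theorems.StickyWulffConstantGenericWallFloorStackLedgerLocalSepTilt
import Summits.Ventures.Crystal3D.Theorems.StickyWulffConstantGenericWallFloorAtHalfTiltDown
import Summits.Ventures.Crystal3D.Theorems.StickyWulffConstantGenericWallFloorStackLedgerLocalWord
import HarnessLib

/-!
# The two-sided WORD ledger with tilted verticals: chain pairs whose two grains have IN-PLANE slots of
# `e₃`-components `≥ 13/25` / `≤ −13/25` pay the FULL charge `½(κ₁+κ₂)` residual-free
# (crux `GenericWallFloor`, stmt-Ventures-19480, line `WallLedgerG`)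

HONEST FRAMING. Venture `Summits/Ventures/Crystal3D` (cell `crystal3d-full`), helper `--supports` the crux
`GenericWallFloor` of `route-Ventures-StickyWulffConstant`, REGISTERED line `WallLedgerG`, open stub
`stub_twoSlabAdhesion`.  Rung credit only; F-C1 not moved; NOT the crux (the charge `½(κ₁+κ₂)` is `< 1` off the steep
class), and `ExactOnly`(C12-55) [E1] and `StarPairFar` remain inputs BY NAME.

`twoSlabAdhesion_stackLedger_local_word` (19480-p2 g4) is the separated ledger under the WORD CRITERION
(`not_coaxial_of_word`: both steep slots IN the end mirror planes of the reduced word presenting the pair) — the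
`(0,0)` cell of the `Σ3ᵏ` chain pairs, `c₀ = 1`.  `not_coaxial_of_word` is stated for arbitrary walk verticals, so with
the tilted separated ledger `twoSlabAdhesion_stackLedger_local_sep_tilt` (this seat) the same holds for in-plane slots
that are steep only for TILTED verticals:

* `twoSlabAdhesion_stackLedger_local_word_tilt` — verticals `z₁`, `z₂` (`‖z₁ − e₃‖ ≤ 1/4`, `‖z₂ + e₃‖ ≤ 1/4`), slots
  `u₁`, `u₂` steep for them and IN the first / last mirror plane: FULL charge `½(κ₁+κ₂)`, no residual;
* **`genericWallFloorAtCharge_word2_of_inner`** — for a chain pair `A₂·Λ₀ = (wordFrame A₁ κ)·Λ₀`, `|κ| ≥ 2`, ANY slot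
  `u₁` in the first mirror plane with `⟪A₁u₁, e₃⟫ ≥ 13/25` and ANY slot `u₂` in the last mirror plane with
  `⟪A₂u₂, e₃⟫ ≤ −13/25`: `GenericWallFloorAtCharge (½(√2⟪A₁u₁,e₃⟫ + √2|⟪A₂u₂,e₃⟫|))` (`≥ 0.73`), modulo
  `ExactOnly`(C12-55) and `StarPairFar`; no vertical in the statement.

WHY (seat census `calc/sigma9_census.py`, 3000 Haar `Σ9` pairs): both end planes carry such in-plane slots on `67 %` of
`Σ9`; inside the ray-aligned residual this lifts `31 %` of the «one grain separated» class from `c₀ = ½` to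
`0.88–0.999` and `50 %` of the mutual-arrival class from `≈ 0` to `0.74–0.99`.
WHAT THIS IS NOT: not `c₀ = 1` on the core; F-C1 not moved.
-/

noncomputable section

namespace Summit.Ventures.Crystal3D.Theorems

open Summit.Ventures.Crystal3D Finset
open Literature.MathematicalPhysics.StatisticalMechanics (fccStacking barlowStacking IsHaggSeq contactDeficiency)
open scoped InnerProductSpace

open scoped Classical in
/-- **The two-sided word ledger with tilted verticals (full charge, no residual).**  Chain pair
`A₂·Λ₀ = (wordFrame A₁ κ)·Λ₀` (reduced model menu word, `|κ| ≥ 2`); unit verticals `z₁`, `z₂` with `‖z₁ − e₃‖ ≤ 1/4`,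
`‖z₂ + e₃‖ ≤ 1/4`; slots `u₁` (steep for `z₁`, IN the first mirror plane) and `u₂` (steep for `z₂`, IN the last mirror
plane).  Inputs `ExactOnly`(C12-55), `DoubleStarCoaxialAt`, `CapPairCoaxial`. -/
theorem twoSlabAdhesion_stackLedger_local_word_tilt
    {s₀ : EuclideanSpace ℝ (Fin 3)} (hs₀ : s₀ ∈ fccSlots)
    (hcert : ExactOnly 0 (fccSlots.filter fun w => 0 < ⟪w, s₀⟫_ℝ))
    (hDS : ∀ F₁ F₂ : EuclideanSpace ℝ (Fin 3) ≃ₗᵢ[ℝ] EuclideanSpace ℝ (Fin 3), DoubleStarCoaxialAt F₁ F₂)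
    (hCP : CapPairCoaxial)
    (A₁ : EuclideanSpace ℝ (Fin 3) ≃ₗᵢ[ℝ] EuclideanSpace ℝ (Fin 3)) (t₁ : EuclideanSpace ℝ (Fin 3))
    (A₂ : EuclideanSpace ℝ (Fin 3) ≃ₗᵢ[ℝ] EuclideanSpace ℝ (Fin 3)) (t₂ : EuclideanSpace ℝ (Fin 3))
    {z₁ : EuclideanSpace ℝ (Fin 3)} (hz₁ : ‖z₁‖ = 1) (hze₁ : ‖z₁ - EuclideanSpace.single (2 : Fin 3) (1 : ℝ)‖ ≤ 1 / 4)
    {z₂ : EuclideanSpace ℝ (Fin 3)} (hz₂ : ‖z₂‖ = 1) (hze₂ : ‖z₂ + EuclideanSpace.single (2 : Fin 3) (1 : ℝ)‖ ≤ 1 / 4)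
    {u₁ : EuclideanSpace ℝ (Fin 3)} (hu₁ : u₁ ∈ fccSlots) (hsteep₁ : Real.sqrt 2 / 2 ≤ ⟪A₁ u₁, z₁⟫_ℝ)
    {u₂ : EuclideanSpace ℝ (Fin 3)} (hu₂ : u₂ ∈ fccSlots) (hsteep₂ : Real.sqrt 2 / 2 ≤ ⟪A₂ u₂, z₂⟫_ℝ)
    (κ : List (EuclideanSpace ℝ (Fin 3)))
    (hκl : ∀ μ ∈ κ, ‖μ‖ = 1 ∧
      ∀ w ∈ fccSlots, ⟪w, μ⟫_ℝ = 0 ∨ ⟪w, μ⟫_ℝ = Real.sqrt (2 / 3) ∨ ⟪w, μ⟫_ℝ = -Real.sqrt (2 / 3))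
    (hκc : List.IsChain (fun μ μ' => ⟪μ, μ'⟫_ℝ = 1 / 3 ∨ ⟪μ, μ'⟫_ℝ = -1 / 3) κ) (hκ2 : 2 ≤ κ.length)
    (hA₂ : A₂ '' fccStacking 1 (Real.sqrt (2 / 3)) = (wordFrame A₁ κ) '' fccStacking 1 (Real.sqrt (2 / 3)))
    (hfirst : ∀ μ, κ.getLast? = some μ → ⟪u₁, μ⟫_ℝ = 0)
    (hlast : ∀ μ, κ.head? = some μ → ⟪A₂ u₂, wordFrame A₁ κ μ⟫_ℝ = 0) :
    TwoSlabLedgerAt ((Real.sqrt 2 * |⟪A₁ u₁, EuclideanSpace.single (2 : Fin 3) (1 : ℝ)⟫_ℝ| +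
        Real.sqrt 2 * |⟪A₂ u₂, EuclideanSpace.single (2 : Fin 3) (1 : ℝ)⟫_ℝ|) / 2) A₁ t₁ A₂ t₂ :=
  twoSlabAdhesion_stackLedger_local_sep_tilt hs₀ hcert hDS hCP A₁ t₁ A₂ t₂ hz₁ hze₁ hz₂ hze₂ hu₁ hsteep₁ hu₂ hsteep₂
    {F | ∃ stk : List WalkEntry, StackSound z₁ stk ∧ StackWF z₁ stk ∧ stk.getLast? = some ⟨A₁, u₁, 0⟩ ∧
      ∃ e ∈ stk, e.frame = F}
    {F | ∃ stk : List WalkEntry, StackSound z₂ stk ∧ StackWF z₂ stk ∧ stk.getLast? = some ⟨A₂, u₂, 0⟩ ∧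
      ∃ e ∈ stk, e.frame = F}
    (fun stk hS hW hl e he => ⟨stk, hS, hW, hl, e, he, rfl⟩)
    (fun stk hS hW hl e he => ⟨stk, hS, hW, hl, e, he, rfl⟩)
    (fun _ ⟨_, hS₁, hW₁, hl₁, _, he₁, hF₁⟩ _ ⟨_, hS₂, hW₂, hl₂, _, he₂, hF₂⟩ => by
      rw [← hF₁, ← hF₂]
      exact not_coaxial_of_word κ hκl hκc hκ2 hA₂ hfirst hlast hS₁ hW₁ hl₁ hS₂ hW₂ hl₂ he₁ he₂)

open scoped Classical in
/-- **`GenericWallFloor` per pair at charge `½(κ₁+κ₂)` under the two-sided word criterion, tilted verticals**,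
modulo `ExactOnly`(C12-55) and `StarPairFar` (explicit verticals). -/
theorem genericWallFloorAtCharge_word2_tilt_of_far
    {s₀ : EuclideanSpace ℝ (Fin 3)} (hs₀ : s₀ ∈ fccSlots)
    (hcert : ExactOnly 0 (fccSlots.filter fun w => 0 < ⟪w, s₀⟫_ℝ)) (hfar : StarPairFar)
    (A₁ : EuclideanSpace ℝ (Fin 3) ≃ₗᵢ[ℝ] EuclideanSpace ℝ (Fin 3)) (t₁ : EuclideanSpace ℝ (Fin 3))
    (A₂ : EuclideanSpace ℝ (Fin 3) ≃ₗᵢ[ℝ] EuclideanSpace ℝ (Fin 3)) (t₂ : EuclideanSpace ℝ (Fin 3))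
    {z₁ : EuclideanSpace ℝ (Fin 3)} (hz₁ : ‖z₁‖ = 1) (hze₁ : ‖z₁ - EuclideanSpace.single (2 : Fin 3) (1 : ℝ)‖ ≤ 1 / 4)
    {z₂ : EuclideanSpace ℝ (Fin 3)} (hz₂ : ‖z₂‖ = 1) (hze₂ : ‖z₂ + EuclideanSpace.single (2 : Fin 3) (1 : ℝ)‖ ≤ 1 / 4)
    {u₁ : EuclideanSpace ℝ (Fin 3)} (hu₁ : u₁ ∈ fccSlots) (hsteep₁ : Real.sqrt 2 / 2 ≤ ⟪A₁ u₁, z₁⟫_ℝ)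
    {u₂ : EuclideanSpace ℝ (Fin 3)} (hu₂ : u₂ ∈ fccSlots) (hsteep₂ : Real.sqrt 2 / 2 ≤ ⟪A₂ u₂, z₂⟫_ℝ)
    (κ : List (EuclideanSpace ℝ (Fin 3)))
    (hκl : ∀ μ ∈ κ, ‖μ‖ = 1 ∧
      ∀ w ∈ fccSlots, ⟪w, μ⟫_ℝ = 0 ∨ ⟪w, μ⟫_ℝ = Real.sqrt (2 / 3) ∨ ⟪w, μ⟫_ℝ = -Real.sqrt (2 / 3))
    (hκc : List.IsChain (fun μ μ' => ⟪μ, μ'⟫_ℝ = 1 / 3 ∨ ⟪μ, μ'⟫_ℝ = -1 / 3) κ) (hκ2 : 2 ≤ κ.length)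
    (hA₂ : A₂ '' fccStacking 1 (Real.sqrt (2 / 3)) = (wordFrame A₁ κ) '' fccStacking 1 (Real.sqrt (2 / 3)))
    (hfirst : ∀ μ, κ.getLast? = some μ → ⟪u₁, μ⟫_ℝ = 0)
    (hlast : ∀ μ, κ.head? = some μ → ⟪A₂ u₂, wordFrame A₁ κ μ⟫_ℝ = 0) :
    GenericWallFloorAtCharge ((Real.sqrt 2 * |⟪A₁ u₁, EuclideanSpace.single (2 : Fin 3) (1 : ℝ)⟫_ℝ| +
        Real.sqrt 2 * |⟪A₂ u₂, EuclideanSpace.single (2 : Fin 3) (1 : ℝ)⟫_ℝ|) / 2) A₁ t₁ A₂ t₂ :=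
  genericWallFloorAtCharge_of_ledger _ A₁ t₁ A₂ t₂
    (twoSlabAdhesion_stackLedger_local_word_tilt hs₀ hcert (doubleStarCoaxialAt_of_starPairFar hfar)
      (capPairCoaxial_of_starPairFar hfar) A₁ t₁ A₂ t₂ hz₁ hze₁ hz₂ hze₂ hu₁ hsteep₁ hu₂ hsteep₂ κ hκl hκc hκ2 hA₂
      hfirst hlast)

open scoped Classical in
/-- **`GenericWallFloor` per pair at charge `½(κ₁+κ₂)` under the two-sided word criterion for in-plane slots of
`e₃`-components `≥ 13/25` and `≤ −13/25`** (verticals chosen by `exists_tilt_vertical{,_down}`): chain pair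
`A₂·Λ₀ = (wordFrame A₁ κ)·Λ₀`, `|κ| ≥ 2`, slot `u₁` IN the first mirror plane with `⟪A₁u₁, e₃⟫ ≥ 13/25`, slot `u₂` IN the
last mirror plane with `⟪A₂u₂, e₃⟫ ≤ −13/25`; modulo `ExactOnly`(C12-55) and `StarPairFar`.  The charge is `≥ 11/15`. -/
theorem genericWallFloorAtCharge_word2_of_inner
    {s₀ : EuclideanSpace ℝ (Fin 3)} (hs₀ : s₀ ∈ fccSlots)
    (hcert : ExactOnly 0 (fccSlots.filter fun w => 0 < ⟪w, s₀⟫_ℝ)) (hfar : StarPairFar)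
    (A₁ : EuclideanSpace ℝ (Fin 3) ≃ₗᵢ[ℝ] EuclideanSpace ℝ (Fin 3)) (t₁ : EuclideanSpace ℝ (Fin 3))
    (A₂ : EuclideanSpace ℝ (Fin 3) ≃ₗᵢ[ℝ] EuclideanSpace ℝ (Fin 3)) (t₂ : EuclideanSpace ℝ (Fin 3))
    {u₁ : EuclideanSpace ℝ (Fin 3)} (hu₁ : u₁ ∈ fccSlots)
    (hup : (13 / 25 : ℝ) ≤ ⟪A₁ u₁, EuclideanSpace.single (2 : Fin 3) (1 : ℝ)⟫_ℝ)
    {u₂ : EuclideanSpace ℝ (Fin 3)} (hu₂ : u₂ ∈ fccSlots)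
    (hdown : ⟪A₂ u₂, EuclideanSpace.single (2 : Fin 3) (1 : ℝ)⟫_ℝ ≤ -(13 / 25 : ℝ))
    (κ : List (EuclideanSpace ℝ (Fin 3)))
    (hκl : ∀ μ ∈ κ, ‖μ‖ = 1 ∧
      ∀ w ∈ fccSlots, ⟪w, μ⟫_ℝ = 0 ∨ ⟪w, μ⟫_ℝ = Real.sqrt (2 / 3) ∨ ⟪w, μ⟫_ℝ = -Real.sqrt (2 / 3))
    (hκc : List.IsChain (fun μ μ' => ⟪μ, μ'⟫_ℝ = 1 / 3 ∨ ⟪μ, μ'⟫_ℝ = -1 / 3) κ) (hκ2 : 2 ≤ κ.length)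
    (hA₂ : A₂ '' fccStacking 1 (Real.sqrt (2 / 3)) = (wordFrame A₁ κ) '' fccStacking 1 (Real.sqrt (2 / 3)))
    (hfirst : ∀ μ, κ.getLast? = some μ → ⟪u₁, μ⟫_ℝ = 0)
    (hlast : ∀ μ, κ.head? = some μ → ⟪A₂ u₂, wordFrame A₁ κ μ⟫_ℝ = 0) :
    GenericWallFloorAtCharge ((Real.sqrt 2 * |⟪A₁ u₁, EuclideanSpace.single (2 : Fin 3) (1 : ℝ)⟫_ℝ| +
        Real.sqrt 2 * |⟪A₂ u₂, EuclideanSpace.single (2 : Fin 3) (1 : ℝ)⟫_ℝ|) / 2) A₁ t₁ A₂ t₂ := by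
  obtain ⟨z₁, hz₁, hze₁, hsteep₁⟩ := exists_tilt_vertical
    (by rw [LinearIsometryEquiv.norm_map, norm_eq_one_of_mem_fccSlots hu₁]) hup
  obtain ⟨z₂, hz₂, hze₂, hsteep₂⟩ := exists_tilt_vertical_down
    (by rw [LinearIsometryEquiv.norm_map, norm_eq_one_of_mem_fccSlots hu₂]) hdown
  exact genericWallFloorAtCharge_word2_tilt_of_far hs₀ hcert hfar A₁ t₁ A₂ t₂ hz₁ hze₁ hz₂ hze₂ hu₁ hsteep₁ hu₂ hsteep₂ κ
    hκl hκc hκ2 hA₂ hfirst hlast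

/-- The charge of `genericWallFloorAtCharge_word2_of_inner` is at least `11/15 > 0.73`. -/
theorem charge_word2_lower {c₁ c₂ : ℝ} (hc₁ : (13 / 25 : ℝ) ≤ c₁) (hc₂ : c₂ ≤ -(13 / 25 : ℝ)) :
    (11 / 15 : ℝ) ≤ (Real.sqrt 2 * |c₁| + Real.sqrt 2 * |c₂|) / 2 := by
  have h1 := charge_of_inner_ge_lower hc₁
  have h2 := charge_of_inner_le_lower hc₂
  rw [abs_of_nonneg (by linarith : (0 : ℝ) ≤ c₁)]
  linarith

end Summit.Ventures.Crystal3D.Theorems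

end
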